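import Literature.Algebra.Lie.SpecialUnitaryAdjointIrreducible
import Literature.LinearAlgebra.Matrix.UnitaryGramSchmidtRetraction
import Literature.LinearAlgebra.Matrix.SpecialOrthogonalGroupConnected
import HarnessLib

/-!
# The adjoint representation `Ad : U(3) → SO(8)` in an orthonormal basis of `𝔰𝔲(3)`: a subgroup of `SO(8)` all of
# whose elements have a fixed vector and which acts irreducibly on `ℝ⁸` [Sikora2017, §2; Hall2015, Prop. 3.24, 7.31]

statement-level skeleton of published theorems with citation tags; proofs where landed; nothing here is a claim about
the Yang–Mills mass gap (cell `lit-balaban` page-1 framing sentence — classical support file of that cell, unit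
`lit-balaban-p24` gen 20, own-lane free target of the Lie ∕ linear-algebra lineage; no SKELETON row).

Topic `LinearAlgebra/Matrix`.  We realise the adjoint action `X ↦ U X U*` of `U(3)` on the real `8`-dimensional space
`𝔰𝔲(3)` (traceless skew-Hermitian `3 × 3` matrices; `dim_ℝ = 3² − 1 = 8`, tree `finrank_suAlgebra`) as real `8 × 8`
matrices, using an orthonormal basis for the Hilbert–Schmidt inner product `Re tr(XᴴY)`:

* §1 `toE : M₃(ℂ) ≃ₗ[ℝ] EuclideanSpace ℂ (Fin 3 × Fin 3)` (entries as coordinates; the real inner product of the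
  Euclidean space is `Re tr(XᴴY)`, `inner_toE`), `suE` = the image of `𝔰𝔲(3)`, `finrank_suE : dim = 8`, and the
  orthonormal basis `suBasis : OrthonormalBasis (Fin 8) ℝ suE` (Mathlib `stdOrthonormalBasis`, reindexed).
* §2 `adLin U : suE →ₗ[ℝ] suE`, `x ↦ U x U*` (`𝔰𝔲(3)` is `Ad U(3)`-stable), an isometry (`inner_adLin`), packaged as
  `adIso U : suE ≃ₗᵢ[ℝ] suE`; `adLin_mul`, `adLin_one`.
* §3 **`adMatrix U ∈ SO(8)`**: the matrix of `adLin U` in `suBasis` is orthogonal (change of orthonormal basis,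
  Mathlib `OrthonormalBasis.toMatrix_orthonormalBasis_mem_orthogonal`) and has determinant `1` — `U(3)` is path
  connected (tree instance `pathConnectedSpace_unitaryGroup`), `U ↦ det (adMatrix U)` is continuous with values in
  `{1, −1}` and value `1` at `U = 1`; `adMatrix_mul`/`adMatrix_one`; the bundled hom
  **`adSO8 : U(3) →* SO(8)`**.
* §4 **EVERY `adMatrix U` HAS A NON-ZERO FIXED VECTOR** (`exists_ne_zero_mulVec_eq`): transport of
  `SpecialUnitaryAdjointIrreducible.exists_mem_su_ne_zero_conj_eq`.
* §5 **THE IMAGE ACTS IRREDUCIBLY ON `ℝ⁸`** (`eq_bot_or_eq_top_of_forall_mulVec_mem`): a subspace of `Fin 8 → ℝ`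
  stable under all `adMatrix U` is `⊥` or `⊤` — transport of
  `SpecialUnitaryAdjointIrreducible.eq_bot_or_eq_top_of_forall_unitary_conj_mem` through `toE` and the coordinate
  isomorphism of `suBasis`.

§4 and §5 are the two inputs of A. S. Sikora's mechanism [Sikora2017, §2, proof of Theorem «undisting» — there with
`SO(5) → SO(14)`]; the companion `Balaban1983to89/WilsonLoopsNotCompleteSO8.lean` draws the consequences for `SO(8)`
(word-wise conjugacy without simultaneous conjugacy).  Nothing in this file is specific to lattice gauge theory.

## References

* [Sikora2017] A. S. Sikora, *SO(2n,ℂ)-character varieties are not varieties of characters*, J. Algebra 478 (2017)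
  195–214, §2 (the mechanism: an irreducible orthogonal representation every element of which has eigenvalue `1`).
* [Hall2015] B. C. Hall, *Lie Groups, Lie Algebras, and Representations*, 2nd ed., GTM 222 (2015), Prop. 3.24
  (`𝔰𝔲(n)`), §7.7.1 / Prop. 7.31 (simplicity), Def. 3.32ff (`Ad`).
* [BrockerTomDieck1985] T. Bröcker, T. tom Dieck, *Representations of Compact Lie Groups*, GTM 98 (1985), I (2.18)
  (`dim SU(n) = n² − 1`).

Mathlib (this pin): `EuclideanSpace`, `stdOrthonormalBasis`, `OrthonormalBasis.toMatrix_orthonormalBasis_mem_orthogonal`,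
`LinearMap.toMatrix`, `Matrix.orthogonalGroup`/`specialOrthogonalGroup`; no adjoint representation of a matrix group
as a homomorphism into an orthogonal group.
-/

noncomputable section

open Matrix
open scoped InnerProductSpace ComplexConjugate

namespace Literature.LinearAlgebra.Matrix.AdjointSU3Orthogonal

open Literature.Algebra.Lie.SpecialUnitaryAdjointIrreducible (exists_mem_su_ne_zero_conj_eq
  eq_bot_or_forall_mem_of_forall_unitary_conj_mem)
open Literature.MathematicalPhysics.QuantumLattice (finrank_suAlgebra)
open Literature.MathematicalPhysics.QuantumFieldTheory (suAlgebra mem_suAlgebra_iff)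

/-! ## §1 Hilbert–Schmidt coordinates on `M₃(ℂ)` and an orthonormal basis of `𝔰𝔲(3)` -/

/-- The Euclidean model of `M₃(ℂ)`: complex `9`-space with its standard Hermitian (and underlying real) inner
product. [folklore] -/
abbrev E : Type := EuclideanSpace ℂ (Fin 3 × Fin 3)

/-- `M₃(ℂ) ≃ ℂ^{3×3}` as REAL vector spaces: a matrix is sent to the family of its entries. [folklore] -/
def toE : Matrix (Fin 3) (Fin 3) ℂ ≃ₗ[ℝ] E where
  toFun X := WithLp.toLp 2 fun p => X p.1 p.2
  invFun x := Matrix.of fun i j => x (i, j)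
  map_add' X Y := by ext p; rfl
  map_smul' c X := by ext p; rfl
  left_inv X := by ext i j; rfl
  right_inv x := by ext p; rfl

/-- Entries of `toE X`. [folklore] -/
@[simp] private theorem toE_apply (X : Matrix (Fin 3) (Fin 3) ℂ) (p : Fin 3 × Fin 3) : toE X p = X p.1 p.2 := rfl

/-- **The real inner product of the Euclidean model is the Hilbert–Schmidt form `Re tr(XᴴY)`.** [cite: Hall2015, Exercise 7.3] -/
theorem inner_toE (X Y : Matrix (Fin 3) (Fin 3) ℂ) : ⟪toE X, toE Y⟫_ℝ = (Xᴴ * Y).trace.re := by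
  refine (real_inner_eq_re_inner ℂ (toE X) (toE Y)).trans ?_
  rw [PiLp.inner_apply]
  simp only [Matrix.trace, Matrix.diag, Matrix.mul_apply, Matrix.conjTranspose_apply, map_sum, RCLike.re_to_complex,
    Complex.re_sum, RCLike.inner_apply', toE_apply]
  rw [Fintype.sum_prod_type, Finset.sum_comm]
  rfl

/-- Conjugation by a unitary preserves the Hilbert–Schmidt form: `Re tr((UXU*)ᴴ(UYU*)) = Re tr(XᴴY)` («the adjoint action
of 𝔨 is unitary»). [cite: Hall2015, Proposition 7.4 (7.1)] -/
theorem inner_toE_conj (U : Matrix.unitaryGroup (Fin 3) ℂ) (X Y : Matrix (Fin 3) (Fin 3) ℂ) :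
    ⟪toE ((U : Matrix (Fin 3) (Fin 3) ℂ) * X * star (U : Matrix (Fin 3) (Fin 3) ℂ)),
      toE ((U : Matrix (Fin 3) (Fin 3) ℂ) * Y * star (U : Matrix (Fin 3) (Fin 3) ℂ))⟫_ℝ = ⟪toE X, toE Y⟫_ℝ := by
  rw [inner_toE, inner_toE]
  set u : Matrix (Fin 3) (Fin 3) ℂ := (U : Matrix (Fin 3) (Fin 3) ℂ) with hu_def
  have hu : star u * u = 1 := Matrix.mem_unitaryGroup_iff'.1 U.2
  rw [Matrix.star_eq_conjTranspose] at hu ⊢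
  have : (u * X * uᴴ)ᴴ * (u * Y * uᴴ) = u * (Xᴴ * Y) * uᴴ := by
    rw [conjTranspose_mul, conjTranspose_mul, conjTranspose_conjTranspose]
    calc u * (Xᴴ * uᴴ) * (u * Y * uᴴ) = u * Xᴴ * (uᴴ * u) * Y * uᴴ := by simp only [Matrix.mul_assoc]
      _ = u * (Xᴴ * Y) * uᴴ := by rw [hu, Matrix.mul_one]; simp only [Matrix.mul_assoc]
  rw [this, Matrix.trace_mul_cycle, hu, Matrix.one_mul]

/-- `𝔰𝔲(3)` inside the Euclidean model: the image of the tree's `suAlgebra 3` (`Xᴴ = −X ∧ tr X = 0`, the carrier of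
`CompactKillingForm.su (Fin 3)`). [folklore] -/
def suE : Submodule ℝ E := (suAlgebra 3).map (toE : Matrix (Fin 3) (Fin 3) ℂ →ₗ[ℝ] E)

/-- Membership in `suE`: `x ∈ suE ↔ toE⁻¹ x ∈ 𝔰𝔲(3)`. [folklore] -/
private theorem mem_suE_iff (x : E) : x ∈ suE ↔ (toE.symm x)ᴴ = -toE.symm x ∧ (toE.symm x).trace = 0 := by
  rw [suE, Submodule.mem_map_equiv, mem_suAlgebra_iff]

/-- `toE X ∈ suE ↔ X ∈ 𝔰𝔲(3)`. [folklore] -/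
private theorem toE_mem_suE_iff (X : Matrix (Fin 3) (Fin 3) ℂ) : toE X ∈ suE ↔ Xᴴ = -X ∧ X.trace = 0 := by
  rw [mem_suE_iff, LinearEquiv.symm_apply_apply]

/-- **`dim_ℝ 𝔰𝔲(3) = 8`** in the Euclidean model (tree `finrank_suAlgebra`: `n² − 1`). [cite: BrockerTomDieck1985, I (2.18)] -/
theorem finrank_suE : Module.finrank ℝ suE = 8 := by
  rw [suE, LinearEquiv.finrank_map_eq, finrank_suAlgebra]
  norm_num

/-- An orthonormal basis of `𝔰𝔲(3)` for `Re tr(XᴴY)`, indexed by `Fin 8`. [folklore] -/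
def suBasis : OrthonormalBasis (Fin 8) ℝ suE := (stdOrthonormalBasis ℝ suE).reindex (finCongr finrank_suE)

/-! ## §2 The adjoint action on `𝔰𝔲(3)` as real linear isometries -/

/-- `𝔰𝔲(n)` is stable under conjugation by unitaries: `(UXU*)ᴴ = −UXU*`, `tr(UXU*) = tr X = 0`. [cite: Hall2015, Proposition 3.24] -/
theorem conj_mem_su {n : Type*} [Fintype n] [DecidableEq n] {U X : Matrix n n ℂ}
    (hU : U ∈ Matrix.unitaryGroup n ℂ) (hX : Xᴴ = -X ∧ X.trace = 0) :
    (U * X * star U)ᴴ = -(U * X * star U) ∧ (U * X * star U).trace = 0 := by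
  rw [Matrix.star_eq_conjTranspose]
  refine ⟨?_, ?_⟩
  · rw [conjTranspose_mul, conjTranspose_mul, conjTranspose_conjTranspose, hX.1, Matrix.neg_mul, Matrix.mul_neg,
      Matrix.mul_assoc]
  · have hu : Uᴴ * U = 1 := by
      have := Matrix.mem_unitaryGroup_iff'.1 hU; rwa [Matrix.star_eq_conjTranspose] at this
    rw [Matrix.trace_mul_cycle, hu, Matrix.one_mul, hX.2]

/-- The matrix behind a vector of `suE` lies in `𝔰𝔲(3)`. [folklore] -/
private theorem toE_symm_mem_su (x : suE) :
    (toE.symm (x : E))ᴴ = -toE.symm (x : E) ∧ (toE.symm (x : E)).trace = 0 := (mem_suE_iff _).1 x.2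

/-- **`Ad U` on `𝔰𝔲(3) ⊂ E`**: `x ↦ U x U*`, a real linear map of `suE`. [cite: Hall2015, Proposition 3.24] -/
def adLin (U : Matrix.unitaryGroup (Fin 3) ℂ) : suE →ₗ[ℝ] suE where
  toFun x := ⟨toE ((U : Matrix (Fin 3) (Fin 3) ℂ) * toE.symm (x : E) * star (U : Matrix (Fin 3) (Fin 3) ℂ)),
    (toE_mem_suE_iff _).2 (conj_mem_su U.2 (toE_symm_mem_su x))⟩
  map_add' x y := by
    apply Subtype.ext
    simp only [Submodule.coe_add, map_add, Matrix.mul_add, Matrix.add_mul]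
  map_smul' c x := by
    apply Subtype.ext
    simp only [SetLike.val_smul, map_smul, Matrix.mul_smul, Matrix.smul_mul, RingHom.id_apply]

/-- The vector of `adLin U x` is `toE (U (toE⁻¹ x) U*)`. [folklore] -/
@[simp] private theorem coe_adLin (U : Matrix.unitaryGroup (Fin 3) ℂ) (x : suE) :
    ((adLin U x : suE) : E) =
      toE ((U : Matrix (Fin 3) (Fin 3) ℂ) * toE.symm (x : E) * star (U : Matrix (Fin 3) (Fin 3) ℂ)) := rfl

/-- `Ad(UV) = Ad U ∘ Ad V`. [folklore] -/
private theorem adLin_mul (U V : Matrix.unitaryGroup (Fin 3) ℂ) : adLin (U * V) = adLin U ∘ₗ adLin V := by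
  refine LinearMap.ext fun x => Subtype.ext ?_
  simp only [coe_adLin, LinearMap.coe_comp, Function.comp_apply, LinearEquiv.symm_apply_apply,
    Submonoid.coe_mul, star_mul, Matrix.mul_assoc]

/-- `Ad 1 = id`. [folklore] -/
private theorem adLin_one : adLin 1 = LinearMap.id := by
  refine LinearMap.ext fun x => Subtype.ext ?_
  simp only [coe_adLin, OneMemClass.coe_one, star_one, Matrix.one_mul, Matrix.mul_one, LinearEquiv.apply_symm_apply,
    LinearMap.id_coe, id_eq]

/-- `Ad U* ∘ Ad U = id`. [folklore] -/
private theorem adLin_star_comp (U : Matrix.unitaryGroup (Fin 3) ℂ) : adLin (star U) ∘ₗ adLin U = LinearMap.id := by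
  rw [← adLin_mul, Unitary.star_mul_self, adLin_one]

/-- **`Ad U` is an isometry of `(𝔰𝔲(3), Re tr(XᴴY))`.** [cite: Hall2015, Proposition 7.4 (7.1)] -/
theorem inner_adLin (U : Matrix.unitaryGroup (Fin 3) ℂ) (x y : suE) : ⟪adLin U x, adLin U y⟫_ℝ = ⟪x, y⟫_ℝ := by
  rw [Submodule.coe_inner, Submodule.coe_inner, coe_adLin, coe_adLin, inner_toE_conj, LinearEquiv.apply_symm_apply,
    LinearEquiv.apply_symm_apply]

/-- `Ad U` as a linear automorphism of `suE` (inverse `Ad U*`). [folklore] -/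
def adEquiv (U : Matrix.unitaryGroup (Fin 3) ℂ) : suE ≃ₗ[ℝ] suE :=
  LinearEquiv.ofLinear (adLin U) (adLin (star U))
    (by simpa only [star_star] using adLin_star_comp (star U)) (adLin_star_comp U)

/-- `Ad U` as a linear ISOMETRY of `suE`. [cite: Hall2015, Proposition 7.4 (7.1)] -/
def adIso (U : Matrix.unitaryGroup (Fin 3) ℂ) : suE ≃ₗᵢ[ℝ] suE :=
  { adEquiv U with
    norm_map' := fun x => by
      change ‖adLin U x‖ = ‖x‖
      rw [@norm_eq_sqrt_real_inner suE, @norm_eq_sqrt_real_inner suE, inner_adLin] }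

/-- `adIso U` acts as `adLin U`. [folklore] -/
@[simp] private theorem adIso_apply (U : Matrix.unitaryGroup (Fin 3) ℂ) (x : suE) : adIso U x = adLin U x := rfl

/-! ## §3 The matrix of `Ad U` in the orthonormal basis: an element of `SO(8)` -/

/-- **`adMatrix U`**: the real `8 × 8` matrix of `Ad U` on `𝔰𝔲(3)` in the orthonormal basis `suBasis`. [cite: Sikora2017, §2] -/
def adMatrix (U : Matrix.unitaryGroup (Fin 3) ℂ) : Matrix (Fin 8) (Fin 8) ℝ :=
  LinearMap.toMatrix suBasis.toBasis suBasis.toBasis (adLin U)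

/-- The matrix of `Ad U` is the change-of-basis matrix from `suBasis` to its image under the isometry `Ad U`. [folklore] -/
private theorem adMatrix_eq_toMatrix_map (U : Matrix.unitaryGroup (Fin 3) ℂ) :
    adMatrix U = suBasis.toBasis.toMatrix (suBasis.map (adIso U)) := by
  ext i j
  rw [adMatrix, LinearMap.toMatrix_apply, Module.Basis.toMatrix_apply, OrthonormalBasis.map_apply, adIso_apply,
    OrthonormalBasis.coe_toBasis]

/-- **`adMatrix U` IS ORTHOGONAL** (matrix of an isometry in an orthonormal basis). [cite: Hall2015, Proposition 7.4 (7.1)] -/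
theorem adMatrix_mem_orthogonalGroup (U : Matrix.unitaryGroup (Fin 3) ℂ) :
    adMatrix U ∈ Matrix.orthogonalGroup (Fin 8) ℝ := by
  rw [adMatrix_eq_toMatrix_map]
  exact OrthonormalBasis.toMatrix_orthonormalBasis_mem_orthogonal _ _

/-- `adMatrix (UV) = adMatrix U · adMatrix V` (`Ad` is a homomorphism). [cite: Hall2015, Proposition 7.4 (7.1)] -/
theorem adMatrix_mul (U V : Matrix.unitaryGroup (Fin 3) ℂ) : adMatrix (U * V) = adMatrix U * adMatrix V := by
  rw [adMatrix, adLin_mul, LinearMap.toMatrix_comp suBasis.toBasis suBasis.toBasis suBasis.toBasis]; rfl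

/-- `adMatrix 1 = 1`. [cite: Hall2015, Proposition 7.4 (7.1)] -/
theorem adMatrix_one : adMatrix 1 = 1 := by
  rw [adMatrix, adLin_one, LinearMap.toMatrix_id]

/-- Entries of `adMatrix U`: `⟪bᵢ, Ad U bⱼ⟫`, i.e. `Re tr(Bᵢᴴ · U Bⱼ U*)` for the basis matrices. [folklore] -/
private theorem adMatrix_apply (U : Matrix.unitaryGroup (Fin 3) ℂ) (i j : Fin 8) :
    adMatrix U i j = ⟪((suBasis i : suE) : E),
      toE ((U : Matrix (Fin 3) (Fin 3) ℂ) * toE.symm ((suBasis j : suE) : E) * star (U : Matrix (Fin 3) (Fin 3) ℂ))⟫_ℝ := by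
  rw [adMatrix, LinearMap.toMatrix_apply, OrthonormalBasis.coe_toBasis, OrthonormalBasis.coe_toBasis_repr_apply,
    OrthonormalBasis.repr_apply_apply, Submodule.coe_inner, coe_adLin]

/-- `U ↦ adMatrix U` is continuous on `U(3)`. [folklore] -/
private theorem continuous_adMatrix : Continuous adMatrix := by
  refine continuous_pi fun i => continuous_pi fun j => ?_
  simp only [adMatrix_apply]
  refine continuous_const.inner ?_
  have htoE : Continuous (toE : Matrix (Fin 3) (Fin 3) ℂ → E) :=
    (toE : Matrix (Fin 3) (Fin 3) ℂ ≃ₗ[ℝ] E).toLinearMap.continuous_of_finiteDimensional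
  refine htoE.comp ?_
  exact ((continuous_subtype_val.mul continuous_const).mul continuous_subtype_val.star)

/-- **`det (adMatrix U) = 1`**: `U(3)` is path connected (tree instance `pathConnectedSpace_unitaryGroup`), and the
continuous function `U ↦ det (adMatrix U)` takes values in `{1, −1}` (tree
`det_eq_one_or_eq_neg_one_of_mem_orthogonalGroup`) with value `1` at `U = 1`, so it never takes the value `−1` (else,
by connectedness, it would take the value `0`) — the image of the adjoint representation lies in `SO`, as Sikora's
`ρ : Γ → SO(2n, ℂ)`. [cite: Sikora2017, §2 (proof of Theorem «undisting»)] -/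
theorem det_adMatrix (U : Matrix.unitaryGroup (Fin 3) ℂ) : (adMatrix U).det = 1 := by
  rcases det_eq_one_or_eq_neg_one_of_mem_orthogonalGroup (adMatrix_mem_orthogonalGroup U) with h | h
  · exact h
  · exfalso
    have hcont : Continuous fun V : Matrix.unitaryGroup (Fin 3) ℂ => (adMatrix V).det :=
      continuous_adMatrix.matrix_det
    have hpre := isPreconnected_range hcont
    have h1 : (1 : ℝ) ∈ Set.range fun V : Matrix.unitaryGroup (Fin 3) ℂ => (adMatrix V).det :=
      ⟨1, by simp only [adMatrix_one, Matrix.det_one]⟩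
    have hm1 : (-1 : ℝ) ∈ Set.range fun V : Matrix.unitaryGroup (Fin 3) ℂ => (adMatrix V).det := ⟨U, h⟩
    have h0 : (0 : ℝ) ∈ Set.range fun V : Matrix.unitaryGroup (Fin 3) ℂ => (adMatrix V).det :=
      hpre.Icc_subset hm1 h1 ⟨by norm_num, by norm_num⟩
    obtain ⟨V, hV⟩ := h0
    dsimp only at hV
    rcases det_eq_one_or_eq_neg_one_of_mem_orthogonalGroup (adMatrix_mem_orthogonalGroup V) with hV' | hV' <;>
      · rw [hV'] at hV; norm_num at hV

/-- **`adMatrix U ∈ SO(8)`.** [cite: Sikora2017, §2] -/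
theorem adMatrix_mem_specialOrthogonalGroup (U : Matrix.unitaryGroup (Fin 3) ℂ) :
    adMatrix U ∈ Matrix.specialOrthogonalGroup (Fin 8) ℝ :=
  Matrix.mem_specialOrthogonalGroup_iff.2 ⟨adMatrix_mem_orthogonalGroup U, det_adMatrix U⟩

/-- **THE ADJOINT REPRESENTATION `Ad : U(3) →* SO(8)`** (in the orthonormal basis `suBasis` of `𝔰𝔲(3)`).
[cite: Sikora2017, §2] -/
def adSO8 : Matrix.unitaryGroup (Fin 3) ℂ →* Matrix.specialOrthogonalGroup (Fin 8) ℝ where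
  toFun U := ⟨adMatrix U, adMatrix_mem_specialOrthogonalGroup U⟩
  map_one' := Subtype.ext adMatrix_one
  map_mul' U V := Subtype.ext (adMatrix_mul U V)

/-- The matrix of `adSO8 U` is `adMatrix U`. [cite: Sikora2017, §2 (proof of Theorem «undisting»)] -/
@[simp] theorem coe_adSO8 (U : Matrix.unitaryGroup (Fin 3) ℂ) :
    ((adSO8 U : Matrix.specialOrthogonalGroup (Fin 8) ℝ) : Matrix (Fin 8) (Fin 8) ℝ) = adMatrix U := rfl

/-! ## §4 Every `Ad U` has a non-zero fixed vector -/

/-- The coordinate isomorphism `suE ≃ ℝ⁸` of the orthonormal basis. [folklore] -/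
def coord : suE ≃ₗ[ℝ] (Fin 8 → ℝ) := suBasis.toBasis.equivFun

/-- Coordinates are the basis coefficients. [folklore] -/
private theorem coord_eq_repr (x : suE) : coord x = ⇑(suBasis.toBasis.repr x) := by
  funext i
  rw [coord, Module.Basis.equivFun_apply]

/-- `adMatrix U` acts on coordinates as `Ad U` acts on vectors. [folklore] -/
private theorem adMatrix_mulVec_coord (U : Matrix.unitaryGroup (Fin 3) ℂ) (x : suE) :
    adMatrix U *ᵥ coord x = coord (adLin U x) := by
  rw [coord_eq_repr, coord_eq_repr, adMatrix]
  exact LinearMap.toMatrix_mulVec_repr suBasis.toBasis suBasis.toBasis (adLin U) x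

/-- **EVERY ELEMENT OF `Ad(U(3)) ⊂ SO(8)` HAS EIGENVALUE `1`**: for each `U ∈ U(3)` there is `v ≠ 0` in `ℝ⁸` with
`adMatrix U · v = v` (the coordinates of a non-zero `X ∈ 𝔰𝔲(3)` commuting with `U`).
[cite: Sikora2017, §2 (proof of Theorem «undisting»)] -/
theorem exists_ne_zero_mulVec_eq (U : Matrix.unitaryGroup (Fin 3) ℂ) :
    ∃ v : Fin 8 → ℝ, v ≠ 0 ∧ adMatrix U *ᵥ v = v := by
  obtain ⟨X, hXsu, hX0, hfix⟩ :=
    exists_mem_su_ne_zero_conj_eq (n := Fin 3) (by rw [Fintype.card_fin]; norm_num) U.2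
  let x : suE := ⟨toE X, (toE_mem_suE_iff X).2 hXsu⟩
  have hx : adLin U x = x := by
    apply Subtype.ext
    rw [coe_adLin]
    change toE ((U : Matrix (Fin 3) (Fin 3) ℂ) * toE.symm (toE X) * star (U : Matrix (Fin 3) (Fin 3) ℂ)) = toE X
    rw [LinearEquiv.symm_apply_apply, hfix]
  refine ⟨coord x, fun h0 => hX0 ?_, by rw [adMatrix_mulVec_coord, hx]⟩
  have hx0 : x = 0 := coord.map_eq_zero_iff.1 h0
  have : toE X = 0 := congrArg Subtype.val hx0
  exact toE.map_eq_zero_iff.1 this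

/-! ## §5 `Ad(U(3))` acts irreducibly on `ℝ⁸` -/

/-- **`Ad(U(3))`-STABLE SUBSPACES OF `suE` ARE `⊥` OR `⊤`** (transport of the matrix statement through `toE`).
[cite: Hall2015, Proposition 7.31] -/
theorem eq_bot_or_eq_top_of_forall_adLin_mem (W : Submodule ℝ suE) (hW : ∀ U, ∀ x ∈ W, adLin U x ∈ W) :
    W = ⊥ ∨ W = ⊤ := by
  -- the matrix subspace behind `W`
  let W₀ : Submodule ℝ (Matrix (Fin 3) (Fin 3) ℂ) :=
    (W.map suE.subtype).map (toE.symm : E →ₗ[ℝ] Matrix (Fin 3) (Fin 3) ℂ)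
  have hmem : ∀ X, X ∈ W₀ ↔ ∃ x ∈ W, toE.symm (x : E) = X := fun X => by
    simp only [W₀, Submodule.mem_map, Submodule.subtype_apply, LinearEquiv.coe_coe, exists_exists_and_eq_and]
  have hle : ∀ X ∈ W₀, Xᴴ = -X ∧ X.trace = 0 := fun X hX => by
    obtain ⟨x, -, rfl⟩ := (hmem X).1 hX
    exact toE_symm_mem_su x
  have hinv : ∀ U ∈ Matrix.unitaryGroup (Fin 3) ℂ, ∀ w ∈ W₀, U * w * star U ∈ W₀ := fun U hU w hw => by
    obtain ⟨x, hx, rfl⟩ := (hmem w).1 hw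
    refine (hmem _).2 ⟨adLin ⟨U, hU⟩ x, hW _ x hx, ?_⟩
    rw [coe_adLin, LinearEquiv.symm_apply_apply]
  rcases eq_bot_or_forall_mem_of_forall_unitary_conj_mem W₀ hle hinv with h | h
  · left
    rw [eq_bot_iff]
    intro x hx
    have : toE.symm (x : E) ∈ W₀ := (hmem _).2 ⟨x, hx, rfl⟩
    rw [h, Submodule.mem_bot, LinearEquiv.map_eq_zero_iff] at this
    rw [Submodule.mem_bot]
    exact Subtype.ext this
  · right
    rw [eq_top_iff]
    intro x _
    have hx : toE.symm (x : E) ∈ W₀ := h _ (toE_symm_mem_su x).1 (toE_symm_mem_su x).2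
    obtain ⟨y, hy, hyx⟩ := (hmem _).1 hx
    have : y = x := Subtype.ext (toE.symm.injective hyx)
    rwa [← this]

/-- **`Ad(U(3)) ⊂ SO(8)` ACTS IRREDUCIBLY ON `ℝ⁸`**: a real subspace of `Fin 8 → ℝ` stable under every `adMatrix U`
is `⊥` or `⊤` (the input «the image is irreducible, so its commutant consists of scalars» of Sikora's mechanism).
[cite: Sikora2017, §2 (proof of Theorem «undisting»); Hall2015, Proposition 7.31] -/
theorem eq_bot_or_eq_top_of_forall_mulVec_mem (W : Submodule ℝ (Fin 8 → ℝ))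
    (hW : ∀ U, ∀ v ∈ W, adMatrix U *ᵥ v ∈ W) : W = ⊥ ∨ W = ⊤ := by
  let W₁ : Submodule ℝ suE := W.comap (coord : suE →ₗ[ℝ] (Fin 8 → ℝ))
  have h₁ : ∀ U, ∀ x ∈ W₁, adLin U x ∈ W₁ := fun U x hx => by
    change coord (adLin U x) ∈ W
    rw [← adMatrix_mulVec_coord]
    exact hW U _ hx
  rcases eq_bot_or_eq_top_of_forall_adLin_mem W₁ h₁ with h | h
  · left
    rw [eq_bot_iff]
    intro v hv
    have : coord.symm v ∈ W₁ := by
      change coord (coord.symm v) ∈ W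
      rwa [LinearEquiv.apply_symm_apply]
    rw [h, Submodule.mem_bot, LinearEquiv.map_eq_zero_iff] at this
    rw [Submodule.mem_bot, this]
  · right
    rw [eq_top_iff]
    intro v _
    have : coord.symm v ∈ W₁ := by rw [h]; exact Submodule.mem_top
    change coord (coord.symm v) ∈ W at this
    rwa [LinearEquiv.apply_symm_apply] at this

end Literature.LinearAlgebra.Matrix.AdjointSU3Orthogonal
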